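import Summits.QuantumFields.YangMills.Theorems.BalabanUVNodesN18StationaryKernelOfKernelLetters
import Summits.QuantumFields.YangMills.Theorems.BalabanUVNodesN18AtRecordOfKernelLetters
import Summits.QuantumFields.YangMills.Theorems.BalabanUVNodesSpineRatesHolder

/-!
# BalabanUVNodes ∕ N18 — THE F-E SHADOW ON NODE N18: what a FIRST-ENTRY-ONLY term family does to N18's BOX-KEYED letter `KernelStepRate`
# (exact kernel theorems; the refutation road; the run-keyed survivor; record ∕ K3⁸ editions under the node-U3 pin)
# (Track A, DAG node N18 = NE5; cluster K4 «SpineRates»; key K3⁸ `SpineGivenEndpointR13SepCoPHV` = stmt-QuantumFields-27366, skeleton v6 b4e55110ab73e679 (K3⁷ 20544 aside);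
# width seat `pub-ymgap-dag-n18-w1` g6, FILE 1 of 2 — FILE 2 `…N18KernelLettersFirstEntryOnlyModel` is the marginal-transport MODEL where the box letter fails and the run-keyed
# letter holds exactly)

HONEST FRAMING.  Count-neutral kernel bookkeeping BY NAME (`--kind proof --supports stmt-QuantumFields-27366 --as helper`).  Elementary real analysis (two triangle
inequalities, dominated summation via pv10∕t4's `secondMoment_sub_abs_le`, uniqueness of limits) over LANDED tree definitions cited by name: def-W1's `kernelA` ∕
`prependCoupling` ∕ `Window` ∕ `objectsOfRecord₁₃` (`Node00/U3OfKernels`, `Node00/RateRecord11`), W1-21's `KernelStepRate(OfRecord₁₃)` (`Node00/U3KernelLetters`), def-B's `betaMerged` ∕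
`betaOfRecord₁₃`, P1's `betaInf`, this lineage's g2 `n18At_rateCarriers_of_kernels_pin_iff_letter` and g5 `tendsto_kernelEntry_revHist_stationary` ∕ `tendsto_betaMerged_revHist_betaInf`,
dag-n16-e's `RatesHolderAt` (`…SpineRatesHolder`; K3's `PHolderD4 β D R := RatesHolderAt D R β ∧ ReadOutAt D R.u3 ∧ …` of `…K3V5Defs`∕`…K3V6Defs` is NOT imported — theses-cone
hygiene — and follows by one projection in the K3 cone).  The FIRST-ENTRY-ONLY property («the level-(k+1) kernels read
the coupling history ONLY through its entry 0 = the bare coupling») is a DISPLAYED HYPOTHESIS on a GENERIC term family — it is the ym-nodeO cell's finding F-E ∕ H_FE′ (IDEA-1 g12,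
CRIT-1 g5∕g6, CRIT-2 g3 E-CRIT2-2, 2026-08-28, `Cruxes/EndpointGivenBR13SepCoPH/CRIT-1-FINDINGCHECK-F-E-idea1-g12.md` ∕ `…CRIT-1-CROSSREAD-E-CRIT2-2-geometric-letters.md`) read at the KERNELS of
the SAME object (`objectsOfRecord₁₃` IS `objects` at `mergedTermFamilyMatT … (TβOfRecord₁₃) (chiβOfRecord₁₃ θ) θ.εbg`, whose `effActionHT = printedSeq … (wilsonTerm (g 0))` is where IDEA-1 located
that free entries `g_j`, `j ≥ 1`, enter only as gauge-fixing prefactors); whether Bałaban's merged term of record IS first-entry-only (H_FE′ = exact FP-independence of the soft gauge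
fixing, [I] (0.15)–(0.16)) is the F-E desk's question (node00-def ∕ def-T, director-ym №210 «def-level first») and is ASSERTED NOWHERE below.  `KernelStepRate` (N18's input — NE5 NOT
PRINTED for d = 4) and the (5.10) clause ((D4)'s input) are displayed hypotheses as in the whole lineage.  Nothing of Bałaban's is asserted, inhabited, discharged or refuted; N17 ∕ N18 ∕
N22 NOT discharged; K3⁸ OPEN (v6), `stub_rates13HV` ∕ `stub_expansion13HV` NOT proved and NOT refuted (§4's last theorem is a LOCATED statement about ONE tuple under displayed hypotheses,
not a `¬ stub`); K3⁷ 20544 aside.  Counts UNMOVED (typed 28∕28 · discharged 5∕27, A 5∕28).  One finite four-torus programme at fixed `ε`, Bałaban AS PRINTED; route R4 closes ONLY the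
conditional finite-𝕋⁴ rung `BalabanLadder.UV` — NOT the continuum limit, NOT ℝ⁴, NOT OS, NOT the Yang–Mills mass gap, NOT Clay.  THEOREMS ONLY: 0 `def`, 0 `instance`, 0 `sorry`,
standard axioms.

WHY.  N18's letter of record — `KernelStepRateOfRecord₁₃ F N θ κ θ₅ C₅`, i.e. `|Π_{k+1}(g; z) − Π_{k+2}(b, g; z)| ≤ C₅ θ₅^{k+1} e^{−κ|z|₁}` for EVERY `b ∈ ]0,θ.γ]` and EVERY `g` in the
box `Window θ.γ` (what K3⁸'s N18 conjunct `N18At R.u3` COSTS under the pin `U3PinnedKernels`, g2 p597580) — PREPENDS `b` as the NEW entry 0.  If the kernels are first-entry-only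
(`Π_{k+1}(g; ·) = f_k(g 0)`), the two sides read INDEPENDENT box points: `f_k(g 0)` against `f_{k+1}(b)`.  §1: two instances of the letter at the common prepended entry and one
triangle inequality force `|Π_{k+1}(g; z) − Π_{k+1}(g'; z)| ≤ 2C₅θ^{k+1}e^{−κ|z|₁}` for ALL `g, g'` in the box — the kernels, the merged β-functions (`2C₅·β′·θ^{k+1}` on boxes) and,
in the level limit, g5's stationary kernel and node U2's continuum β-functional are COUPLING-BLIND to geometric order (the functional is ONE NUMBER).  §2 is the contrapositive =
THE REFUTATION ROAD the ym-nodeO critics' BN-N mechanism walks (CRIT-2 S.2003 ∕ CRIT-1 §1: under H_FE′ + the transport identification the level-k β of record varies over the box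
like `|β₁|∕(ck)` — polynomial, not `θ^k`): first-entry-only ∧ ONE gap `> 2C₅θ^{k+1}e^{−κ|z|₁}` ⟹ `¬ KernelStepRate`.  §3 is the SURVIVOR: the RUN-KEYED step rate (compare only at
`g 0 = nx b`, `nx` a run map into `]0,γ]` — what print's NE5 mechanism actually compares: run B = run A with ONE extra ultraviolet step at MATCHED running couplings), which the box
letter implies and which, under first-entry-only, reads on first entries alone (FILE 2: it holds with constant 0 at the marginal-transport model where the box letter fails for
every `(C₅, θ < 1)`).  §4 reads §1–§2 at the record and through K3's pin: mod the displayed hypotheses, `RatesHolderAt D (rateCarriersOfRecord₁₃CoPH 𝔯 …) β` — hence K3⁸'s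
`PHolderD4 β D (rrOfRecord 𝔯 ksel …)` — FAILS at any tuple carrying a β₁₃-gap — a located input for the K3 keying (R-N18-RUN: key NE5 on the tuned runs' sequences, which is all `T4OutputRate.u3_threeBrackets` evaluates, not on the box that
`SpineRates.ReadOutAt`'s first clause forces) and for the F-E repair desk; NOT a re-cut ask, NOT a stub refutation.

WHAT (theorems only).  §1 `kernelA_eq_of_termFirstEntryOnly` · ★ `abs_kernelA_sub_le_of_kernelStepRate_firstEntryOnly` · `decay510_kernelA_sub_of_kernelStepRate_firstEntryOnly` ·
★ `abs_betaMerged_sub_le_of_kernelStepRate_firstEntryOnly` · `stationaryKernel_eq_of_kernelStepRate_firstEntryOnly` · `betaInf_betaMerged_eq_of_kernelStepRate_firstEntryOnly`.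
§2 ★ `not_kernelStepRate_of_firstEntryOnly_of_kernelGap` · `forall_not_kernelStepRate_of_firstEntryOnly_of_notRigid` · `not_kernelStepRate_of_firstEntryOnly_of_betaGap`.
§3 `runStepRate_of_kernelStepRate` · `kernelStepRate_iff_firstEntries_of_firstEntryOnly` · `runStepRate_iff_firstEntries_of_firstEntryOnly`.
§4 `abs_betaOfRecord₁₃_sub_le_of_kernelStepRateOfRecord₁₃_firstEntryOnly` · ★ `not_kernelStepRateOfRecord₁₃_of_firstEntryOnly_of_betaGap` · ★ `not_n18At_of_kernels_pin_firstEntryOnly_betaGap` ·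
★ `not_ratesHolderAt_of_kernels_pin_firstEntryOnly_betaGap`.

References (TYPES ∕ locators only): [Balaban1987RG1] CMP **109** (1987): (0.15)–(0.19) pp. 254–255 (the recursion seeded by the Wilson term; gauge fixing), p. 259 Thm 1 (NE5 NOT
printed) and L4–9 («no scaling transformations here»), (1.18) p. 263, (1.20)–(1.22) p. 264, (2.12)–(2.14) p. 268, (5.10) p. 293, §5 p. 298.
-/

noncomputable section

open Filter Topology
open scoped BigOperators

namespace YMDAG.N18.KernelLettersFirstEntryOnly

open Literature.MathematicalPhysics.QuantumFieldTheory.Balaban1983to89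
open Literature.MathematicalPhysics.QuantumFieldTheory.Balaban1983to89.T4Continuum (T4Family ULoop)
open Literature.MathematicalPhysics.QuantumFieldTheory.Balaban1983to89.T4OutputRate (Window)
open Literature.MathematicalPhysics.QuantumFieldTheory.Balaban1983to89.FlowStep (Box HBeta mem_box)
open Literature.MathematicalPhysics.QuantumFieldTheory.Balaban1983to89.B12Beta (secondMoment)
open Literature.MathematicalPhysics.QuantumFieldTheory.Balaban1983to89.T4FlagMemory (extd extd_coe)
open Literature.MathematicalPhysics.QuantumFieldTheory.Balaban1983to89.T4BetaReadOut (extd_mem_window)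
open Literature.MathematicalPhysics.QuantumFieldTheory.Balaban1983to89.T4BetaReadOutLipschitz (secondMoment_sub_abs_le)
open Literature.MathematicalPhysics.QuantumFieldTheory.Balaban1983to89.T4BetaStationary (SeqBox revHist betaInf revHist_mem_box revHist_zero)
open Literature.MathematicalPhysics.QuantumFieldTheory.Balaban1983to89.Node00 (TermFamily1 betaMerged betaOfMerged betaOfRecord₁₃ prependCoupling U3Letters₁₁ Stage13Params
  Stage13HParams)
open Literature.MathematicalPhysics.QuantumFieldTheory.Balaban1983to89.Node00.U3OfKernels (kernelA EA pt objectsOfRecord₁₃ histPrefix histPrefix_apply kernelA_eq KernelDecay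
  KernelDecayOfRecord₁₃ secondMoment_kernelA_extd prependCoupling_mem_window)
open Literature.MathematicalPhysics.QuantumFieldTheory.Balaban1983to89.Node00.U3KernelLetters (KernelStepRate KernelStepRateOfRecord₁₃)
open Literature.MathematicalPhysics.QuantumFieldTheory.Balaban1983to89.B12Sec2to5 (l1 Decay510 betaPrime510)
open YMDAG.N18.StationaryKernelOfKernelLetters (tendsto_kernelEntry_revHist_stationary tendsto_betaMerged_revHist_betaInf)
open YMDAG.N18.AtRecordOfKernelLetters (n18At_rateCarriers_of_kernels_pin_iff_letter)
open YMDAG.UVSplit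
open Summit.QuantumFields.YangMills.BalabanUVNodes.SpineRatesHolder (RatesHolderAt)

section Generic

variable {𝔄 : Type*} [NormedRing 𝔄] [NormedAlgebra ℝ 𝔄]
variable {V : Type*} [NormedAddCommGroup V] [NormedSpace ℝ V] {ι : Type*} [Fintype ι]
variable (F : T4Family) (ℰ : TermFamily1 F 𝔄) (ρ : V →L[ℝ] 𝔄) (bV : Module.Basis ι ℝ V)

/-! ## §1 FIRST-ENTRY-ONLY ∧ N18's BOX-KEYED LETTER ⟹ RIGIDITY: kernels, merged β, stationary kernel and continuum β-functional are COUPLING-BLIND TO GEOMETRIC ORDER -/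

/-- **TERM-LEVEL FIRST-ENTRY-ONLY ⟹ KERNEL-LEVEL FIRST-ENTRY-ONLY.**  If on the boxes the level-`k` term reads the history `(g_0, …, g_k)` only through `g_0` (the DISPLAYED
shape of the ym-nodeO finding F-E ∕ H_FE′ for the tree's free-history object — asserted nowhere), then so do def-W1's limiting (1.21) kernels on the window.
[cite: Balaban1987RG1, (0.17)–(0.19) p.255 and (1.21) p.264 (bookkeeping; the first-entry-only reading is a hypothesis, NOT print)] -/
theorem kernelA_eq_of_termFirstEntryOnly {γ : ℝ}
    (hFEt : ∀ (k : ℕ) (v w : Fin (k + 1) → ℝ), v ∈ Box γ k → w ∈ Box γ k → v 0 = w 0 → ∀ K, ℰ k v K = ℰ k w K)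
    {g g' : ℕ → ℝ} (hg : g ∈ Window γ) (hg' : g' ∈ Window γ) (h0 : g 0 = g' 0) (k : ℕ) :
    kernelA F ℰ ρ bV g k = kernelA F ℰ ρ bV g' k := by
  rw [kernelA_eq, kernelA_eq]
  have hfun : (fun K => ℰ k (histPrefix g k) K) = fun K => ℰ k (histPrefix g' k) K :=
    funext fun K => hFEt k _ _ (mem_box.mpr fun i => hg i) (mem_box.mpr fun i => hg' i) (by simp [h0]) K
  rw [hfun]

/-- ★ **RIGIDITY — N18's BOX-KEYED LETTER AT A FIRST-ENTRY-ONLY FAMILY FORCES THE KERNELS COUPLING-BLIND TO GEOMETRIC ORDER.**  Under `KernelStepRate F ℰ ρ bV γ κ θ C₅`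
(`|Π_{k+1}(g; z) − Π_{k+2}(b, g; z)| ≤ C₅θ^{k+1}e^{−κ|z|₁}` for every `b ∈ ]0,γ]`, `g ∈ ]0,γ]^ℕ` — N18's input, NE5 NOT PRINTED for d = 4) and the DISPLAYED first-entry-only
hypothesis on the window, for ALL `g, g'` in the window (no relation between them): `|Π_{k+1}(g; z) − Π_{k+1}(g'; z)| ≤ 2·C₅θ^{k+1}e^{−κ|z|₁}`.  Proof: the letter at
`(b, g)` and at `(b, g')` with the common new first entry `b := g 0`; the two prepended kernels COINCIDE (first entries both `b`); triangle.  The mechanism of the ym-nodeO critics'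
`geomRigid_of_firstEntryOnly_fading` (β-level, `Cruxes/…/Idea5g12RunCurrencySketch5.lean` :1460), here for N18's letter at the kernels. [cite: Balaban1987RG1, Thm 1 p.259 and (1.21) p.264] -/
theorem abs_kernelA_sub_le_of_kernelStepRate_firstEntryOnly {γ κ θ C₅ : ℝ} (h18 : KernelStepRate F ℰ ρ bV γ κ θ C₅)
    (hFE : ∀ g ∈ Window γ, ∀ g' ∈ Window γ, g 0 = g' 0 → ∀ (k : ℕ) (μ ν : Fin 4) (z : Fin 4 → ℤ),
      kernelA F ℰ ρ bV g k μ ν z = kernelA F ℰ ρ bV g' k μ ν z)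
    {g g' : ℕ → ℝ} (hg : g ∈ Window γ) (hg' : g' ∈ Window γ) (k : ℕ) (μ ν : Fin 4) (z : Fin 4 → ℤ) :
    |kernelA F ℰ ρ bV g k μ ν z - kernelA F ℰ ρ bV g' k μ ν z| ≤ 2 * (C₅ * θ ^ (k + 1) * Real.exp (-(κ * l1 z))) := by
  have hb0 : 0 < g 0 := (hg 0).1
  have hbγ : g 0 ≤ γ := (hg 0).2
  have h1 := h18 (g 0) hb0 hbγ g hg k μ ν z
  have h2 := h18 (g 0) hb0 hbγ g' hg' k μ ν z
  have he : kernelA F ℰ ρ bV (prependCoupling (g 0) g) (k + 1) μ ν z = kernelA F ℰ ρ bV (prependCoupling (g 0) g') (k + 1) μ ν z :=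
    hFE _ (prependCoupling_mem_window hb0 hbγ hg) _ (prependCoupling_mem_window hb0 hbγ hg') rfl (k + 1) μ ν z
  rw [he] at h1
  rw [abs_sub_comm] at h2
  calc |kernelA F ℰ ρ bV g k μ ν z - kernelA F ℰ ρ bV g' k μ ν z|
      ≤ |kernelA F ℰ ρ bV g k μ ν z - kernelA F ℰ ρ bV (prependCoupling (g 0) g') (k + 1) μ ν z| +
          |kernelA F ℰ ρ bV (prependCoupling (g 0) g') (k + 1) μ ν z - kernelA F ℰ ρ bV g' k μ ν z| := abs_sub_le _ _ _
    _ ≤ C₅ * θ ^ (k + 1) * Real.exp (-(κ * l1 z)) + C₅ * θ ^ (k + 1) * Real.exp (-(κ * l1 z)) := add_le_add h1 h2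
    _ = 2 * (C₅ * θ ^ (k + 1) * Real.exp (-(κ * l1 z))) := by ring

/-- The same as a (5.10)-CLASS statement for the DIFFERENCE kernel: `Decay510 (Π_{k+1}(g; μν·) − Π_{k+1}(g'; μν·)) (2C₅θ^{k+1}) κ`. [cite: Balaban1987RG1, (5.10) p.293 and Thm 1 p.259] -/
theorem decay510_kernelA_sub_of_kernelStepRate_firstEntryOnly {γ κ θ C₅ : ℝ} (h18 : KernelStepRate F ℰ ρ bV γ κ θ C₅)
    (hFE : ∀ g ∈ Window γ, ∀ g' ∈ Window γ, g 0 = g' 0 → ∀ (k : ℕ) (μ ν : Fin 4) (z : Fin 4 → ℤ),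
      kernelA F ℰ ρ bV g k μ ν z = kernelA F ℰ ρ bV g' k μ ν z)
    {g g' : ℕ → ℝ} (hg : g ∈ Window γ) (hg' : g' ∈ Window γ) (k : ℕ) (μ ν : Fin 4) :
    Decay510 (fun z => kernelA F ℰ ρ bV g k μ ν z - kernelA F ℰ ρ bV g' k μ ν z) (2 * C₅ * θ ^ (k + 1)) κ := by
  intro z
  have h := abs_kernelA_sub_le_of_kernelStepRate_firstEntryOnly F ℰ ρ bV h18 hFE hg hg' k μ ν z
  rw [neg_mul]
  linarith

/-- ★ **THE MERGED β-FUNCTIONS ARE BOXWISE CONSTANT TO GEOMETRIC ORDER.**  Add the (5.10) clause `KernelDecay … (Window γ) 0 1 κ` (one constant per sequence — (D4)'s input,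
only for summability) and `0 < κ`: for all `v, w ∈ ]0,γ]^{k+1}`, `|β_{k+1}(v) − β_{k+1}(w)| ≤ 2C₅·β′·θ^{k+1}` with `β′ = betaPrime510 4 1 κ` — (1.22) is dominated summation
(`secondMoment_sub_abs_le`).  Read against dag-n18-w2's guard `SensitiveOnBoxes`: under the two displayed hypotheses the merged β is coupling-SENSITIVE only through `O(θ^{k+1})`.
[cite: Balaban1987RG1, (1.22) p.264 and (5.10) p.293] -/
theorem abs_betaMerged_sub_le_of_kernelStepRate_firstEntryOnly {γ κ θ C₅ : ℝ} (hκ : 0 < κ) (h18 : KernelStepRate F ℰ ρ bV γ κ θ C₅)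
    (hFE : ∀ g ∈ Window γ, ∀ g' ∈ Window γ, g 0 = g' 0 → ∀ (k : ℕ) (μ ν : Fin 4) (z : Fin 4 → ℤ),
      kernelA F ℰ ρ bV g k μ ν z = kernelA F ℰ ρ bV g' k μ ν z)
    (hdec : KernelDecay F ℰ ρ bV (Window γ) 0 1 κ) {k : ℕ} {v w : Fin (k + 1) → ℝ} (hv : v ∈ Box γ k) (hw : w ∈ Box γ k) :
    |betaMerged F ℰ ρ bV k v - betaMerged F ℰ ρ bV k w| ≤ 2 * C₅ * betaPrime510 4 1 κ * θ ^ (k + 1) := by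
  obtain ⟨C₀, hC₀⟩ := hdec (extd v) (extd_mem_window hv)
  obtain ⟨C₀', hC₀'⟩ := hdec (extd w) (extd_mem_window hw)
  have hD := decay510_kernelA_sub_of_kernelStepRate_firstEntryOnly F ℰ ρ bV h18 hFE (extd_mem_window hv) (extd_mem_window hw) k 0 1
  have h := secondMoment_sub_abs_le (Pk := kernelA F ℰ ρ bV (extd v) k) (Pk' := kernelA F ℰ ρ bV (extd w) k) hκ (hC₀ k) (hC₀' k) hD
  rw [secondMoment_kernelA_extd, secondMoment_kernelA_extd] at h
  refine h.trans (le_of_eq ?_)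
  simp only [betaPrime510, one_mul]
  ring

/-- **g5's STATIONARY KERNEL IS ONE KERNEL** (history-independent): under `KernelStepRate` (`0 ≤ θ < 1`) and first-entry-only, for ALL box-valued reversed histories `h, h'`,
`Π_∞(h)(μ,ν,z) = Π_∞(h')(μ,ν,z)` — the two level sequences converge (g5 `tendsto_kernelEntry_revHist_stationary`) and differ by `≤ 2C₅θ^{k+1}e^{−κ|z|₁} → 0`.
[cite: Balaban1987RG1, (1.21) p.264 and p.255 (one β-function: motivation only)] -/
theorem stationaryKernel_eq_of_kernelStepRate_firstEntryOnly {γ κ θ C₅ : ℝ} (h18 : KernelStepRate F ℰ ρ bV γ κ θ C₅) (hθ0 : 0 ≤ θ) (hθ1 : θ < 1)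
    (hFE : ∀ g ∈ Window γ, ∀ g' ∈ Window γ, g 0 = g' 0 → ∀ (k : ℕ) (μ ν : Fin 4) (z : Fin 4 → ℤ),
      kernelA F ℰ ρ bV g k μ ν z = kernelA F ℰ ρ bV g' k μ ν z)
    {h h' : ℕ → ℝ} (hh : SeqBox γ h) (hh' : SeqBox γ h') (μ ν : Fin 4) (z : Fin 4 → ℤ) :
    betaInf (fun k v => kernelA F ℰ ρ bV (extd v) k μ ν z) h = betaInf (fun k v => kernelA F ℰ ρ bV (extd v) k μ ν z) h' := by
  have t1 := tendsto_kernelEntry_revHist_stationary F ℰ ρ bV h18 hθ1 hh μ ν z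
  have t2 := tendsto_kernelEntry_revHist_stationary F ℰ ρ bV h18 hθ1 hh' μ ν z
  have tsub := t1.sub t2
  have hbound : ∀ k : ℕ, ‖kernelA F ℰ ρ bV (extd (revHist h k)) k μ ν z - kernelA F ℰ ρ bV (extd (revHist h' k)) k μ ν z‖ ≤
      2 * (C₅ * θ ^ (k + 1) * Real.exp (-(κ * l1 z))) := fun k => by
    rw [Real.norm_eq_abs]
    exact abs_kernelA_sub_le_of_kernelStepRate_firstEntryOnly F ℰ ρ bV h18 hFE (extd_mem_window (revHist_mem_box hh k))
      (extd_mem_window (revHist_mem_box hh' k)) k μ ν z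
  have hgeo : Tendsto (fun k : ℕ => 2 * (C₅ * θ ^ (k + 1) * Real.exp (-(κ * l1 z)))) atTop (𝓝 0) := by
    have hp : Tendsto (fun k : ℕ => θ ^ (k + 1)) atTop (𝓝 0) :=
      (tendsto_pow_atTop_nhds_zero_of_lt_one hθ0 hθ1).comp (tendsto_add_atTop_nat 1)
    have := (hp.const_mul C₅).mul_const (Real.exp (-(κ * l1 z)))
    simpa using this.const_mul 2
  have tzero := squeeze_zero_norm hbound hgeo
  exact sub_eq_zero.mp (tendsto_nhds_unique tsub tzero)

/-- **NODE U2's CONTINUUM β-FUNCTIONAL OF THE FAMILY IS ONE NUMBER**: under `KernelStepRate` (`0 ≤ θ < 1`), first-entry-only, the (5.10) clause and `0 < κ`, P1's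
`betaInf (betaMerged F ℰ ρ bV)` takes the SAME value at all box-valued reversed histories (g5 `tendsto_betaMerged_revHist_betaInf` + §1's β-rigidity `2C₅β′θ^{k+1} → 0`).
So, mod the displayed hypotheses, print's «one function β» (p. 255) degenerates further to ONE CONSTANT — the box keying leaves the merged β no room to run.
[cite: Balaban1987RG1, p.255 (motivation) and (1.22) p.264] -/
theorem betaInf_betaMerged_eq_of_kernelStepRate_firstEntryOnly {γ κ θ C₅ : ℝ} (hκ : 0 < κ) (h18 : KernelStepRate F ℰ ρ bV γ κ θ C₅) (hθ0 : 0 ≤ θ) (hθ1 : θ < 1)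
    (hFE : ∀ g ∈ Window γ, ∀ g' ∈ Window γ, g 0 = g' 0 → ∀ (k : ℕ) (μ ν : Fin 4) (z : Fin 4 → ℤ),
      kernelA F ℰ ρ bV g k μ ν z = kernelA F ℰ ρ bV g' k μ ν z)
    (hdec : KernelDecay F ℰ ρ bV (Window γ) 0 1 κ) {h h' : ℕ → ℝ} (hh : SeqBox γ h) (hh' : SeqBox γ h') :
    betaInf (betaMerged F ℰ ρ bV) h = betaInf (betaMerged F ℰ ρ bV) h' := by
  have t1 := tendsto_betaMerged_revHist_betaInf F ℰ ρ bV hκ h18 hθ0 hθ1 hdec hh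
  have t2 := tendsto_betaMerged_revHist_betaInf F ℰ ρ bV hκ h18 hθ0 hθ1 hdec hh'
  have tsub := t1.sub t2
  have hbound : ∀ k : ℕ, ‖betaMerged F ℰ ρ bV k (revHist h k) - betaMerged F ℰ ρ bV k (revHist h' k)‖ ≤ 2 * C₅ * betaPrime510 4 1 κ * θ ^ (k + 1) := fun k => by
    rw [Real.norm_eq_abs]
    exact abs_betaMerged_sub_le_of_kernelStepRate_firstEntryOnly F ℰ ρ bV hκ h18 hFE hdec (revHist_mem_box hh k) (revHist_mem_box hh' k)
  have hgeo : Tendsto (fun k : ℕ => 2 * C₅ * betaPrime510 4 1 κ * θ ^ (k + 1)) atTop (𝓝 0) := by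
    have hp : Tendsto (fun k : ℕ => θ ^ (k + 1)) atTop (𝓝 0) :=
      (tendsto_pow_atTop_nhds_zero_of_lt_one hθ0 hθ1).comp (tendsto_add_atTop_nat 1)
    simpa using hp.const_mul (2 * C₅ * betaPrime510 4 1 κ)
  have tzero := squeeze_zero_norm hbound hgeo
  exact sub_eq_zero.mp (tendsto_nhds_unique tsub tzero)

/-! ## §2 THE REFUTATION ROAD (exact contrapositives): first-entry-only ∧ ONE gap beyond the geometric order ⟹ N18's box-keyed letter FAILS -/

/-- ★ **FIRST-ENTRY-ONLY ∧ ONE KERNEL GAP `> 2C₅θ^{k+1}e^{−κ|z|₁}` between two window sequences ⟹ `¬ KernelStepRate … γ κ θ C₅`.**  The road the critics' BN-N mechanism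
walks at β-level (level-k oscillation `≍ |β₁|∕(ck)` over the box under H_FE′ + the transport identification, CRIT-1 g6 §1) — typed here as the exact kernel statement; which gap (if any)
Bałaban's merged term of record exhibits is NOT claimed. [cite: Balaban1987RG1, Thm 1 p.259 and p.259 L4–9] -/
theorem not_kernelStepRate_of_firstEntryOnly_of_kernelGap {γ κ θ C₅ : ℝ}
    (hFE : ∀ g ∈ Window γ, ∀ g' ∈ Window γ, g 0 = g' 0 → ∀ (k : ℕ) (μ ν : Fin 4) (z : Fin 4 → ℤ),
      kernelA F ℰ ρ bV g k μ ν z = kernelA F ℰ ρ bV g' k μ ν z)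
    {g g' : ℕ → ℝ} (hg : g ∈ Window γ) (hg' : g' ∈ Window γ) {k : ℕ} {μ ν : Fin 4} {z : Fin 4 → ℤ}
    (hgap : 2 * (C₅ * θ ^ (k + 1) * Real.exp (-(κ * l1 z))) < |kernelA F ℰ ρ bV g k μ ν z - kernelA F ℰ ρ bV g' k μ ν z|) :
    ¬ KernelStepRate F ℰ ρ bV γ κ θ C₅ :=
  fun h18 => (not_lt.mpr (abs_kernelA_sub_le_of_kernelStepRate_firstEntryOnly F ℰ ρ bV h18 hFE hg hg' k μ ν z)) hgap

/-- **NO GEOMETRIC CONSTANT AT ALL**: first-entry-only ∧ «no `C` with `|Π_{k+1}(g; z) − Π_{k+1}(g'; z)| ≤ Cθ^{k+1}e^{−κ|z|₁}` on the window» ⟹ the letter fails FOR EVERY `C₅`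
at this `θ` (the shape «polynomial beats geometric» takes at the kernels; FILE 2 instantiates it). [cite: Balaban1987RG1, Thm 1 p.259 and (0.28)–(0.30) p.258] -/
theorem forall_not_kernelStepRate_of_firstEntryOnly_of_notRigid {γ κ θ : ℝ}
    (hFE : ∀ g ∈ Window γ, ∀ g' ∈ Window γ, g 0 = g' 0 → ∀ (k : ℕ) (μ ν : Fin 4) (z : Fin 4 → ℤ),
      kernelA F ℰ ρ bV g k μ ν z = kernelA F ℰ ρ bV g' k μ ν z)
    (hnr : ¬ ∃ C : ℝ, ∀ g ∈ Window γ, ∀ g' ∈ Window γ, ∀ (k : ℕ) (μ ν : Fin 4) (z : Fin 4 → ℤ),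
      |kernelA F ℰ ρ bV g k μ ν z - kernelA F ℰ ρ bV g' k μ ν z| ≤ C * θ ^ (k + 1) * Real.exp (-(κ * l1 z))) (C₅ : ℝ) :
    ¬ KernelStepRate F ℰ ρ bV γ κ θ C₅ := by
  intro h18
  refine hnr ⟨2 * C₅, fun g hg g' hg' k μ ν z => ?_⟩
  have h := abs_kernelA_sub_le_of_kernelStepRate_firstEntryOnly F ℰ ρ bV h18 hFE hg hg' k μ ν z
  calc |kernelA F ℰ ρ bV g k μ ν z - kernelA F ℰ ρ bV g' k μ ν z| ≤ 2 * (C₅ * θ ^ (k + 1) * Real.exp (-(κ * l1 z))) := h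
    _ = 2 * C₅ * θ ^ (k + 1) * Real.exp (-(κ * l1 z)) := by ring

/-- **β-LEVEL GAP**: first-entry-only ∧ the (5.10) clause ∧ ONE pair of box histories at some level with `|β_{k+1}(v) − β_{k+1}(w)| > 2C₅β′θ^{k+1}` ⟹ `¬ KernelStepRate … γ κ θ C₅`
— the currency in which the critics price H_FE′ (the level-k β of record's oscillation over the box). [cite: Balaban1987RG1, (1.22) p.264 and Thm 1 p.259] -/
theorem not_kernelStepRate_of_firstEntryOnly_of_betaGap {γ κ θ C₅ : ℝ} (hκ : 0 < κ)
    (hFE : ∀ g ∈ Window γ, ∀ g' ∈ Window γ, g 0 = g' 0 → ∀ (k : ℕ) (μ ν : Fin 4) (z : Fin 4 → ℤ),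
      kernelA F ℰ ρ bV g k μ ν z = kernelA F ℰ ρ bV g' k μ ν z)
    (hdec : KernelDecay F ℰ ρ bV (Window γ) 0 1 κ) {k : ℕ} {v w : Fin (k + 1) → ℝ} (hv : v ∈ Box γ k) (hw : w ∈ Box γ k)
    (hgap : 2 * C₅ * betaPrime510 4 1 κ * θ ^ (k + 1) < |betaMerged F ℰ ρ bV k v - betaMerged F ℰ ρ bV k w|) :
    ¬ KernelStepRate F ℰ ρ bV γ κ θ C₅ :=
  fun h18 => (not_lt.mpr (abs_betaMerged_sub_le_of_kernelStepRate_firstEntryOnly F ℰ ρ bV hκ h18 hFE hdec hv hw)) hgap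

/-! ## §3 THE SURVIVOR: the RUN-KEYED step rate (compare only at `g 0 = nx b`) — implied by the box letter; under first-entry-only a statement about first entries alone -/

/-- **BOX ⟹ RUN**: N18's box-keyed letter implies the RUN-KEYED step rate for EVERY run map `nx` (inline shape, no `def`: `∀ b ∈ ]0,γ], ∀ g ∈ ]0,γ]^ℕ, g 0 = nx b →
|Π_{k+1}(g; z) − Π_{k+2}(b, g; z)| ≤ C₅θ^{k+1}e^{−κ|z|₁}` — run B = run A with ONE extra ultraviolet step at MATCHED couplings, what print's η-rate mechanism compares).
[cite: Balaban1987RG1, Thm 1 p.259 and (0.18)–(0.20) pp.255–256] -/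
theorem runStepRate_of_kernelStepRate {γ κ θ C₅ : ℝ} (h18 : KernelStepRate F ℰ ρ bV γ κ θ C₅) (nx : ℝ → ℝ) :
    ∀ b : ℝ, 0 < b → b ≤ γ → ∀ g ∈ Window γ, g 0 = nx b → ∀ (k : ℕ) (μ ν : Fin 4) (z : Fin 4 → ℤ),
      |kernelA F ℰ ρ bV g k μ ν z - kernelA F ℰ ρ bV (prependCoupling b g) (k + 1) μ ν z| ≤ C₅ * θ ^ (k + 1) * Real.exp (-(κ * l1 z)) :=
  fun b hb hbγ g hg _ k μ ν z => h18 b hb hbγ g hg k μ ν z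

/-- **UNDER FIRST-ENTRY-ONLY THE BOX LETTER READS ON INDEPENDENT FIRST ENTRIES**: `KernelStepRate … γ κ θ C₅` ⟺ for ALL `b, s ∈ ]0,γ]` (no relation),
`|Π_{k+1}(s, s, …; z) − Π_{k+2}(b, s, s, …; z)| ≤ C₅θ^{k+1}e^{−κ|z|₁}` at the constant representatives — CRIT-1 g6 §1's «compares `F_{k+1}(w 0)` with `F_k(w 1)` at INDEPENDENT box
points», N18 edition. [cite: Balaban1987RG1, Thm 1 p.259 and (1.21) p.264] -/
theorem kernelStepRate_iff_firstEntries_of_firstEntryOnly {γ κ θ C₅ : ℝ}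
    (hFE : ∀ g ∈ Window γ, ∀ g' ∈ Window γ, g 0 = g' 0 → ∀ (k : ℕ) (μ ν : Fin 4) (z : Fin 4 → ℤ),
      kernelA F ℰ ρ bV g k μ ν z = kernelA F ℰ ρ bV g' k μ ν z) :
    KernelStepRate F ℰ ρ bV γ κ θ C₅ ↔
      ∀ b s : ℝ, 0 < b → b ≤ γ → 0 < s → s ≤ γ → ∀ (k : ℕ) (μ ν : Fin 4) (z : Fin 4 → ℤ),
        |kernelA F ℰ ρ bV (fun _ => s) k μ ν z - kernelA F ℰ ρ bV (prependCoupling b fun _ => s) (k + 1) μ ν z| ≤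
          C₅ * θ ^ (k + 1) * Real.exp (-(κ * l1 z)) := by
  constructor
  · intro h18 b s hb hbγ hs hsγ k μ ν z
    exact h18 b hb hbγ (fun _ => s) (fun _ => ⟨hs, hsγ⟩) k μ ν z
  · intro h b hb hbγ g hg k μ ν z
    have hs : (fun _ : ℕ => g 0) ∈ Window γ := fun _ => hg 0
    have e1 : kernelA F ℰ ρ bV g k μ ν z = kernelA F ℰ ρ bV (fun _ => g 0) k μ ν z := hFE g hg _ hs rfl k μ ν z
    have e2 : kernelA F ℰ ρ bV (prependCoupling b g) (k + 1) μ ν z = kernelA F ℰ ρ bV (prependCoupling b fun _ => g 0) (k + 1) μ ν z :=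
      hFE _ (prependCoupling_mem_window hb hbγ hg) _ (prependCoupling_mem_window hb hbγ hs) rfl (k + 1) μ ν z
    rw [e1, e2]
    exact h b (g 0) hb hbγ (hg 0).1 (hg 0).2 k μ ν z

/-- **UNDER FIRST-ENTRY-ONLY THE RUN-KEYED LETTER READS ON THE MATCHED FIRST ENTRIES `(nx b, b)` ALONE**: for a run map `nx : ]0,γ] → ]0,γ]`, the run-keyed step rate ⟺
`∀ b ∈ ]0,γ], |Π_{k+1}(nx b, nx b, …; z) − Π_{k+2}(b, nx b, …; z)| ≤ C₅θ^{k+1}e^{−κ|z|₁}` — ONE comparison per bare coupling, at MATCHED points; no rigidity is forced (FILE 2: constant 0 at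
the marginal-transport model).  The located repair R-N18-RUN for the K3 keying reads N18 in this currency. [cite: Balaban1987RG1, Thm 1 p.259 and (0.18)–(0.20) pp.255–256] -/
theorem runStepRate_iff_firstEntries_of_firstEntryOnly {γ κ θ C₅ : ℝ}
    (hFE : ∀ g ∈ Window γ, ∀ g' ∈ Window γ, g 0 = g' 0 → ∀ (k : ℕ) (μ ν : Fin 4) (z : Fin 4 → ℤ),
      kernelA F ℰ ρ bV g k μ ν z = kernelA F ℰ ρ bV g' k μ ν z)
    {nx : ℝ → ℝ} (hnx : ∀ b : ℝ, 0 < b → b ≤ γ → 0 < nx b ∧ nx b ≤ γ) :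
    (∀ b : ℝ, 0 < b → b ≤ γ → ∀ g ∈ Window γ, g 0 = nx b → ∀ (k : ℕ) (μ ν : Fin 4) (z : Fin 4 → ℤ),
        |kernelA F ℰ ρ bV g k μ ν z - kernelA F ℰ ρ bV (prependCoupling b g) (k + 1) μ ν z| ≤ C₅ * θ ^ (k + 1) * Real.exp (-(κ * l1 z))) ↔
      ∀ b : ℝ, 0 < b → b ≤ γ → ∀ (k : ℕ) (μ ν : Fin 4) (z : Fin 4 → ℤ),
        |kernelA F ℰ ρ bV (fun _ => nx b) k μ ν z - kernelA F ℰ ρ bV (prependCoupling b fun _ => nx b) (k + 1) μ ν z| ≤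
          C₅ * θ ^ (k + 1) * Real.exp (-(κ * l1 z)) := by
  constructor
  · intro h b hb hbγ k μ ν z
    exact h b hb hbγ (fun _ => nx b) (fun _ => hnx b hb hbγ) rfl k μ ν z
  · intro h b hb hbγ g hg hg0 k μ ν z
    have hs : (fun _ : ℕ => nx b) ∈ Window γ := fun _ => hnx b hb hbγ
    have e1 : kernelA F ℰ ρ bV g k μ ν z = kernelA F ℰ ρ bV (fun _ => nx b) k μ ν z := hFE g hg _ hs hg0 k μ ν z
    have e2 : kernelA F ℰ ρ bV (prependCoupling b g) (k + 1) μ ν z = kernelA F ℰ ρ bV (prependCoupling b fun _ => nx b) (k + 1) μ ν z :=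
      hFE _ (prependCoupling_mem_window hb hbγ hg) _ (prependCoupling_mem_window hb hbγ hs) rfl (k + 1) μ ν z
    rw [e1, e2]
    exact h b hb hbγ k μ ν z

end Generic

/-! ## §4 AT THE RECORD, Stage 13, and through K3's node-U3 pin: the β₁₃-gap contrapositive for `KernelStepRateOfRecord₁₃`, `N18At` and `RatesHolderAt` -/

section Record

open scoped Matrix.Norms.L2Operator

variable (F : T4Family) (N : ℕ) [NeZero N]

/-- **THE β OF RECORD IS BOXWISE CONSTANT TO GEOMETRIC ORDER under N18's letter of record + first-entry-only kernels of record** (the DISPLAYED H_FE′ shape at W1-19's objects: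
`(objectsOfRecord₁₃ F N θ ℓ).EA 0 g · X = (objectsOfRecord₁₃ F N θ ℓ).EA 0 g' · X` whenever `g 0 = g' 0` on the window) + (D4)'s (5.10) clause of record at rate `κ > 0`: on every box
`|β₁₃(v) − β₁₃(w)| ≤ 2C₅·β′·θ₅^{k+1}` (`betaOfRecord₁₃ = betaOfMerged (betaMerged …) …` equals the merged β on the box, `betaOfMerged_of_mem`). [cite: Balaban1987RG1, (1.22) p.264 and Thm 1 p.259] -/
theorem abs_betaOfRecord₁₃_sub_le_of_kernelStepRateOfRecord₁₃_firstEntryOnly (θ : Stage13Params F N) (ℓ : U3Letters₁₁) {κ θ₅ C₅ : ℝ} (hκ : 0 < κ)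
    (h18 : KernelStepRateOfRecord₁₃ F N θ κ θ₅ C₅)
    (hFE : ∀ g ∈ Window θ.γ, ∀ g' ∈ Window θ.γ, g 0 = g' 0 → ∀ X,
      (objectsOfRecord₁₃ F N θ ℓ).EA 0 g PUnit.unit X = (objectsOfRecord₁₃ F N θ ℓ).EA 0 g' PUnit.unit X)
    (hdec : KernelDecayOfRecord₁₃ F N θ 0 1 κ) {k : ℕ} {v w : Fin (k + 1) → ℝ} (hv : v ∈ Box θ.γ k) (hw : w ∈ Box θ.γ k) :
    |betaOfRecord₁₃ F N θ k v - betaOfRecord₁₃ F N θ k w| ≤ 2 * C₅ * betaPrime510 4 1 κ * θ₅ ^ (k + 1) := by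
  letI := θ.instVβ₁; letI := θ.instVβ₂; letI := θ.instιβ
  have hFE' : ∀ g ∈ Window θ.γ, ∀ g' ∈ Window θ.γ, g 0 = g' 0 → ∀ (k : ℕ) (μ ν : Fin 4) (z : Fin 4 → ℤ),
      kernelA F (Node00.mergedTermFamilyMatT F N (Node00.TβOfRecord₁₃ F N) (Node00.chiβOfRecord₁₃ F N θ) θ.εbg) θ.ρ8 θ.bV g k μ ν z =
        kernelA F (Node00.mergedTermFamilyMatT F N (Node00.TβOfRecord₁₃ F N) (Node00.chiβOfRecord₁₃ F N θ) θ.εbg) θ.ρ8 θ.bV g' k μ ν z :=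
    fun g hg g' hg' h0 k μ ν z => hFE g hg g' hg' h0 (pt k μ ν z)
  show |betaOfMerged _ _ _ k v - betaOfMerged _ _ _ k w| ≤ _
  rw [Node00.betaOfMerged_of_mem _ _ _ hv, Node00.betaOfMerged_of_mem _ _ _ hw]
  exact abs_betaMerged_sub_le_of_kernelStepRate_firstEntryOnly F _ θ.ρ8 θ.bV hκ h18 hFE' hdec hv hw

/-- ★ **THE β₁₃-GAP CONTRAPOSITIVE FOR N18's LETTER OF RECORD**: first-entry-only kernels of record ∧ the (5.10) clause of record ∧ ONE pair of box histories with
`|β₁₃(v) − β₁₃(w)| > 2C₅β′θ₅^{k+1}` ⟹ `¬ KernelStepRateOfRecord₁₃ F N θ κ θ₅ C₅`.  Mod H_FE′ + the critics' transport identification (β₁₃ at level k oscillating like `|β₁|∕(ck)`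
over the box) such a gap exists at every large `k` for every `θ₅ < 1` — a HEURISTIC of the ym-nodeO cell, displayed here as the hypothesis `hgap`, NOT asserted.
[cite: Balaban1987RG1, Thm 1 p.259, (1.22) p.264 and p.259 L4–9] -/
theorem not_kernelStepRateOfRecord₁₃_of_firstEntryOnly_of_betaGap (θ : Stage13Params F N) (ℓ : U3Letters₁₁) {κ θ₅ C₅ : ℝ} (hκ : 0 < κ)
    (hFE : ∀ g ∈ Window θ.γ, ∀ g' ∈ Window θ.γ, g 0 = g' 0 → ∀ X,
      (objectsOfRecord₁₃ F N θ ℓ).EA 0 g PUnit.unit X = (objectsOfRecord₁₃ F N θ ℓ).EA 0 g' PUnit.unit X)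
    (hdec : KernelDecayOfRecord₁₃ F N θ 0 1 κ) {k : ℕ} {v w : Fin (k + 1) → ℝ} (hv : v ∈ Box θ.γ k) (hw : w ∈ Box θ.γ k)
    (hgap : 2 * C₅ * betaPrime510 4 1 κ * θ₅ ^ (k + 1) < |betaOfRecord₁₃ F N θ k v - betaOfRecord₁₃ F N θ k w|) :
    ¬ KernelStepRateOfRecord₁₃ F N θ κ θ₅ C₅ :=
  fun h18 => (not_lt.mpr (abs_betaOfRecord₁₃_sub_le_of_kernelStepRateOfRecord₁₃_firstEntryOnly F N θ ℓ hκ h18 hFE hdec hv hw)) hgap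

variable {N}

/-- ★ **UNDER THE READING's NODE-U3 PIN AT A TUPLE, THE N18 CONJUNCT FAILS on a β₁₃-gap**: with `(𝔯.lit F θ hP g₀ os).u3 = objectsOfRecord₁₃ F N θ ℓ` (K3's `U3PinnedKernels` at the
tuple), first-entry-only kernels of record, the (5.10) clause of record at `ℓ.κ > 0` and a gap `> 2ℓ.C₅β′ℓ.θ₅^{k+1}`: `¬ N18At (rateCarriersOfRecord₁₃CoPH 𝔯 F θ hP g₀ os j).u3` at EVERY
run length `j` (g2's `n18At_rateCarriers_of_kernels_pin_iff_letter`: the conjunct IS the letter of record). [cite: Balaban1987RG1, Thm 1 p.259 and (1.21)–(1.22) p.264] -/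
theorem not_n18At_of_kernels_pin_firstEntryOnly_betaGap (𝔯 : RateReading₁₃CoPH N) (θ : Stage13HParams F N) (hP : θ.Provisos₁₃CoPH F N)
    (g₀ : ℕ → ℝ) (os : List (ULoop F)) (ℓ : U3Letters₁₁) (hpin : (𝔯.lit F θ hP g₀ os).u3 = objectsOfRecord₁₃ F N θ.toStage13Params ℓ) (hκ : 0 < ℓ.κ)
    (hFE : ∀ g ∈ Window θ.γ, ∀ g' ∈ Window θ.γ, g 0 = g' 0 → ∀ X,
      (objectsOfRecord₁₃ F N θ.toStage13Params ℓ).EA 0 g PUnit.unit X = (objectsOfRecord₁₃ F N θ.toStage13Params ℓ).EA 0 g' PUnit.unit X)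
    (hdec : KernelDecayOfRecord₁₃ F N θ.toStage13Params 0 1 ℓ.κ) {k : ℕ} {v w : Fin (k + 1) → ℝ} (hv : v ∈ Box θ.γ k) (hw : w ∈ Box θ.γ k)
    (hgap : 2 * ℓ.C₅ * betaPrime510 4 1 ℓ.κ * ℓ.θ₅ ^ (k + 1) <
      |betaOfRecord₁₃ F N θ.toStage13Params k v - betaOfRecord₁₃ F N θ.toStage13Params k w|) (j : ℕ) :
    ¬ N18At (rateCarriersOfRecord₁₃CoPH 𝔯 F θ hP g₀ os j).u3 := fun h =>
  not_kernelStepRateOfRecord₁₃_of_firstEntryOnly_of_betaGap F N θ.toStage13Params ℓ hκ hFE hdec hv hw hgap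
    ((n18At_rateCarriers_of_kernels_pin_iff_letter F 𝔯 θ hP g₀ os ℓ hpin j).1 h)

/-- ★ **K3 EDITION: UNDER THE PIN, THE RATES HOLDER OF RECORD FAILS on a β₁₃-gap** — for EVERY `β`, EVERY datum `D` and EVERY run length `j`:
`¬ RatesHolderAt D (rateCarriersOfRecord₁₃CoPH 𝔯 F θ hP g₀ os j) β` (dag-n16-e's R-β holder, whose fifth conjunct is `N18At R.u3`).  In K3⁸'s cone (`…K3V5Defs` ∕ `…K3V6Defs`,
skeleton v6 §1, NOT imported here): `rrOfRecord 𝔯 ksel F θ hP g₀ os = rateCarriersOfRecord₁₃CoPH 𝔯 F θ hP g₀ os (ksel …)` by `rfl` and `PHolderD4 β D R := RatesHolderAt D R β ∧ …`,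
so at any tuple where `U3PinnedKernels 𝔯 ℓ'` supplies `hpin` (with `ℓ := ℓ' F θ`) and the displayed hypotheses hold, `¬ PHolderD4 β D (rrOfRecord 𝔯 ksel F θ hP g₀ os)` is ONE
projection away.  LOCATED input for the K3 keying ∕ the F-E repair desk: mod H_FE′ + the transport identification every tuple with `ℓ.θ₅ < 1` carries such a gap at large `k`, so
stub 1's witness cannot route through the pinned kernels of record while N18 is keyed on the BOX; the run-keyed NE5 (§3) is untouched.  Nothing here negates a registered
stub (the stubs quantify over guarded admissible tuples with (B)+END, whose inhabitation is K0⁷∕open). [cite: Balaban1987RG1, Thm 1 ∕ Thm 2 p.259 and (1.21)–(1.22) p.264] -/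
theorem not_ratesHolderAt_of_kernels_pin_firstEntryOnly_betaGap (𝔯 : RateReading₁₃CoPH N) (θ : Stage13HParams F N) (hP : θ.Provisos₁₃CoPH F N)
    (g₀ : ℕ → ℝ) (os : List (ULoop F)) (ℓ : U3Letters₁₁) (hpin : (𝔯.lit F θ hP g₀ os).u3 = objectsOfRecord₁₃ F N θ.toStage13Params ℓ) (hκ : 0 < ℓ.κ)
    (hFE : ∀ g ∈ Window θ.γ, ∀ g' ∈ Window θ.γ, g 0 = g' 0 → ∀ X,
      (objectsOfRecord₁₃ F N θ.toStage13Params ℓ).EA 0 g PUnit.unit X = (objectsOfRecord₁₃ F N θ.toStage13Params ℓ).EA 0 g' PUnit.unit X)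
    (hdec : KernelDecayOfRecord₁₃ F N θ.toStage13Params 0 1 ℓ.κ) {k : ℕ} {v w : Fin (k + 1) → ℝ} (hv : v ∈ Box θ.γ k) (hw : w ∈ Box θ.γ k)
    (hgap : 2 * ℓ.C₅ * betaPrime510 4 1 ℓ.κ * ℓ.θ₅ ^ (k + 1) <
      |betaOfRecord₁₃ F N θ.toStage13Params k v - betaOfRecord₁₃ F N θ.toStage13Params k w|) (j : ℕ) (β : ℝ) (D : Datum F N) :
    ¬ RatesHolderAt D (rateCarriersOfRecord₁₃CoPH 𝔯 F θ hP g₀ os j) β := fun h =>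
  not_n18At_of_kernels_pin_firstEntryOnly_betaGap F 𝔯 θ hP g₀ os ℓ hpin hκ hFE hdec hv hw hgap j h.2.2.2.2.1

end Record

end YMDAG.N18.KernelLettersFirstEntryOnly
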